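import Summits.SmoothPoincare4.SmoothPoincare4.Theorems.EntropyRungCompactShrinkerGapScalarIdentities
import Summits.SmoothPoincare4.SmoothPoincare4.Theorems.EntropyRungCompactShrinkerGapScalarCurvaturePos
import Summits.SmoothPoincare4.SmoothPoincare4.Theorems.EntropyRungCompactShrinkerGapJensenVolumeBound
import Summits.SmoothPoincare4.SmoothPoincare4.Theorems.EntropyRungCompactShrinkerGapWeightedDirichlet
import Summits.SmoothPoincare4.SmoothPoincare4.Theorems.EntropyRungCompactShrinkerGapVarianceGradSq
import Summits.SmoothPoincare4.SmoothPoincare4.Theorems.EntropyRungCompactShrinkerGapLevelSetCertBase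
import Literature.Geometry.Riemannian.GradientShrinkerProofs
import Literature.Geometry.Riemannian.RicciFlowScalarMaximumPrinciple
import HarnessLib

/-!
# The variance budget from the volume-comparison certificate, `Vol ≤ 96π²` and `R ≤ 10`
(stub `stub_varianceBudget_of_volumeCertificate` of line `cgy-variance-pivot`, crux
`EntropyRung.CompactShrinkerGap`, item stmt-SmoothPoincare4-10870)

The line reduces the crux to the VARIANCE BUDGET `D := ∫(R − 2)² dV < 2V − 96π²` (`V = Vol(M, g)`)
for a closed normalised 4-d gradient shrinker `Ric + Hess f = g/2`, `R + |∇f|² = f` of Gaussian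
mass `Z = ∫e^{-f} dV > Z₀ = 32π²√π e^{-3/2}`. The lead's SECOND LP-dual certificate (the level-set
LP with the volume-comparison row) is ONE pointwise two-variable inequality `Q(f, R) ≤ 0` on the
triangle `{0 ≤ R ≤ f ≤ 10}`,

  `Q(f,R) = (R − 2)² + (38/5)e^{-f} − 2 − (29/20)(R − 2) + 149(f − 2)e^{-f}`
  `        − 41((f − R) − (f − 2)²)e^{-f} + ½((f − R)(3 − R) − (R − 2)²) + 142(e^{-f} − 659/5000)`,

proved separately (stub `stub_volumeCertificate`); HERE it is the first hypothesis, verbatim.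
This file is the integration step: certificate + `Vol ≤ 96π²` + `R ≤ 10` ⇒ the variance budget.

Proof.
1. Pointwise range. `0 < R` on a closed shrinker (`stub_scalarCurvaturePos_of_identities`, with the
   identity (B) of `stub_shrinkerScalarIdentities`); `R ≤ f` since `|∇f|² = f − R ≥ 0`
   (`gradSq_nonneg`); `f ≤ 10` by Fermat: at a maximum point `x₀` of the continuous `f` on the
   compact `M`, `df(x₀) = 0` (`mvfderiv_eq_zero_of_isMaxOn`), so `|∇f|²(x₀) = 0` and
   `f ≤ f(x₀) = R(x₀) ≤ 10`. Hence `Q(f(x), R(x)) ≤ 0` at every point.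
2. Integrate over `dV` (finite measure `riemVolume_eq`, every integrand continuous, hence integrable,
   `integrable_of_continuous`; `integral_nonpos`, linearity `integral_lincomb₈`):
   `−(742/5)Z − (44539/2500)V − (29/20)∫R + 149∫fe^{-f} − 41∫(f−R)e^{-f} + 41∫(f−2)²e^{-f}`
   `+ ½∫(f−R)(3−R) + ½D ≤ 0`.
3. Insert the landed members: `∫R = 2V` (`R + Δf = 2`, `∫Δf = 0`:
   `integral_dalembertian_riemVolume_eq_zero`); `∫fe^{-f} = 2Z` (`integral_mul_exp_neg_eq_two_mul`);
   `∫(f−R)e^{-f} = ∫(f−2)²e^{-f}` (W1, `stub_weightedDirichlet`); `∫(f−R)(3−R) = D`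
   (U1, `stub_variance_eq_gradSq_mul`). Result: `D + (38/5)Z − 2V + 142(Z − (659/5000)V) ≤ 0`.
4. Density and volume: the `lintegral` hypothesis is `Z > Z₀` (`ofReal_integral_eq_lintegral_ofReal`),
   `V ≤ 96π²`, and `(659/5000)·96π² ≤ Z₀`, `96π² ≤ (38/5)Z₀` (both `⟸ 0.3954 ≤ √π·e^{-3/2}`;
   `√π > 1.77245`, `e^{3/2} = (e^{1/2})³ < 4.48169` from `exp_half_lt_d7`; true value `0.395488`),
   so `Z − (659/5000)V > 0` and `D ≤ 2V − (38/5)Z < 2V − 96π²`.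

Sanity check: the round `S⁴(√6)` (`f ≡ R ≡ 2`, `D = 0`, `V = 96π²`): `0 < 96π²`.
Everything is proved; no definition, no named fact, no `sorry`.

References: X. Cheng, E. Ribeiro Jr, D. Zhou, arXiv:2203.14916, Thm. 2 and Remark 2
[ChengRibeiroZhou2022]; J. A. Carrillo, L. Ni, Comm. Anal. Geom. 17 (2009), §4 [CarrilloNi2009].
-/

noncomputable section

-- the registered namespace `Summit.SmoothPoincare4.SmoothPoincare4.Theorems` repeats a component
set_option linter.dupNamespace false

open Bundle Set Function Filter Module MeasureTheory
open scoped Manifold ContDiff Topology ENNReal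

namespace Summit.SmoothPoincare4.SmoothPoincare4.Theorems

open Literature.Geometry Literature.Geometry.Lorentzian Literature.Geometry.Riemannian
  Literature.Geometry.Lorentzian.PseudoRiemannianMetric

/-- **Linearity of the integral for an eight-term combination** (seven integrable functions and a
constant, finite measure): `∫(c₁u₁ + c₂ + c₃u₃ + ⋯ + c₈u₈) = c₁∫u₁ + c₂·μ(univ) + c₃∫u₃ + ⋯ + c₈∫u₈`.
[folklore] -/
private theorem integral_lincomb₈ {α : Type*} [MeasurableSpace α] {μ : Measure α}
    [IsFiniteMeasure μ] {u₁ u₃ u₄ u₅ u₆ u₇ u₈ : α → ℝ}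
    (h₁ : Integrable u₁ μ) (h₃ : Integrable u₃ μ) (h₄ : Integrable u₄ μ) (h₅ : Integrable u₅ μ)
    (h₆ : Integrable u₆ μ) (h₇ : Integrable u₇ μ) (h₈ : Integrable u₈ μ)
    (c₁ c₂ c₃ c₄ c₅ c₆ c₇ c₈ : ℝ) :
    ∫ x, (c₁ * u₁ x + c₂ + c₃ * u₃ x + c₄ * u₄ x + c₅ * u₅ x + c₆ * u₆ x + c₇ * u₇ x + c₈ * u₈ x)
        ∂μ =
      c₁ * ∫ x, u₁ x ∂μ + c₂ * (μ univ).toReal + c₃ * ∫ x, u₃ x ∂μ + c₄ * ∫ x, u₄ x ∂μ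
        + c₅ * ∫ x, u₅ x ∂μ + c₆ * ∫ x, u₆ x ∂μ + c₇ * ∫ x, u₇ x ∂μ + c₈ * ∫ x, u₈ x ∂μ := by
  have s₂ : Integrable (fun x ↦ c₁ * u₁ x + c₂) μ := (h₁.const_mul _).add (integrable_const _)
  have s₃ : Integrable (fun x ↦ c₁ * u₁ x + c₂ + c₃ * u₃ x) μ := s₂.add (h₃.const_mul _)
  have s₄ : Integrable (fun x ↦ c₁ * u₁ x + c₂ + c₃ * u₃ x + c₄ * u₄ x) μ := s₃.add (h₄.const_mul _)
  have s₅ : Integrable (fun x ↦ c₁ * u₁ x + c₂ + c₃ * u₃ x + c₄ * u₄ x + c₅ * u₅ x) μ :=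
    s₄.add (h₅.const_mul _)
  have s₆ : Integrable (fun x ↦ c₁ * u₁ x + c₂ + c₃ * u₃ x + c₄ * u₄ x + c₅ * u₅ x + c₆ * u₆ x) μ :=
    s₅.add (h₆.const_mul _)
  have s₇ : Integrable
      (fun x ↦ c₁ * u₁ x + c₂ + c₃ * u₃ x + c₄ * u₄ x + c₅ * u₅ x + c₆ * u₆ x + c₇ * u₇ x) μ :=
    s₆.add (h₇.const_mul _)
  rw [integral_add s₇ (h₈.const_mul _),
    integral_add s₆ (h₇.const_mul _), integral_add s₅ (h₆.const_mul _),
    integral_add s₄ (h₅.const_mul _), integral_add s₃ (h₄.const_mul _),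
    integral_add s₂ (h₃.const_mul _), integral_add (h₁.const_mul _) (integrable_const _)]
  simp only [integral_const_mul, integral_const, smul_eq_mul, Measure.real]
  ring

/-- **The core numerical constant**: `0.3954 ≤ √π·e^{-3/2}` (true value `0.395488`; `√π > 1.77245`
from `Real.pi_gt_d6`, `e^{3/2} = (e^{1/2})³ < 4.48169` from `exp_half_lt_d7 : e^{1/2} < 1.6487213`;
`1.77245/4.48169 = 0.395487`). [folklore] -/
private theorem d4_le_sqrt_pi_mul_exp_neg_three_halves :
    (0.3954 : ℝ) ≤ Real.sqrt Real.pi * Real.exp (-(3 : ℝ) / 2) := by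
  have hs : (1.77245 : ℝ) < Real.sqrt Real.pi := by
    rw [Real.lt_sqrt (by norm_num)]
    have := Real.pi_gt_d6
    nlinarith
  have ha : Real.exp (1 / 2) < (1.6487213 : ℝ) := by
    have h := exp_half_lt_d7
    norm_num at h ⊢
    exact h
  have ha0 : 0 < Real.exp (1 / 2) := Real.exp_pos _
  have ha3 : Real.exp (1 / 2) ^ 3 < 4.48169 := by
    have h := pow_lt_pow_left₀ ha ha0.le (three_ne_zero)
    norm_num at h
    linarith
  have ht : Real.exp (-(3 : ℝ) / 2) * Real.exp (1 / 2) ^ 3 = 1 := by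
    rw [← Real.exp_nat_mul, ← Real.exp_add]
    norm_num
  have ht0 : 0 < Real.exp (-(3 : ℝ) / 2) := Real.exp_pos _
  nlinarith [mul_nonneg (sub_nonneg.2 hs.le) ht0.le, mul_nonneg (sub_nonneg.2 ha3.le) ht0.le]

/-- **Numerics of the certificate's room**: `96π² ≤ (38/5)·Z₀` with `Z₀ = 32π²√π e^{-3/2}`, i.e.
`96 ≤ 243.2·√π·e^{-3/2}` (`⟸ √π·e^{-3/2} ≥ 0.3954 > 96/243.2 = 0.39474`). [folklore] -/
private theorem ninetySix_pi_sq_le_room :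
    96 * Real.pi ^ 2 ≤ 38 / 5 * (32 * Real.pi ^ 2 * Real.sqrt Real.pi * Real.exp (-(3 : ℝ) / 2)) := by
  have key : (96 : ℝ) ≤ 38 / 5 * 32 * (Real.sqrt Real.pi * Real.exp (-(3 : ℝ) / 2)) := by
    have := d4_le_sqrt_pi_mul_exp_neg_three_halves
    linarith
  have hp : 0 ≤ Real.pi ^ 2 := by positivity
  calc 96 * Real.pi ^ 2 = Real.pi ^ 2 * 96 := by ring
    _ ≤ Real.pi ^ 2 * (38 / 5 * 32 * (Real.sqrt Real.pi * Real.exp (-(3 : ℝ) / 2))) :=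
        mul_le_mul_of_nonneg_left key hp
    _ = 38 / 5 * (32 * Real.pi ^ 2 * Real.sqrt Real.pi * Real.exp (-(3 : ℝ) / 2)) := by ring

/-- **Numerics of the volume-comparison row**: `(659/5000)·96π² ≤ Z₀ = 32π²√π e^{-3/2}`, i.e.
`12.6528 ≤ 32·√π·e^{-3/2}`, i.e. `0.3954 ≤ √π·e^{-3/2}` (true value `0.395488`, margin `9·10⁻⁵`).
[folklore] -/
private theorem volumeRow_le_room :
    659 / 5000 * (96 * Real.pi ^ 2) ≤
      32 * Real.pi ^ 2 * Real.sqrt Real.pi * Real.exp (-(3 : ℝ) / 2) := by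
  have key : (659 / 5000 * 96 : ℝ) ≤ 32 * (Real.sqrt Real.pi * Real.exp (-(3 : ℝ) / 2)) := by
    have := d4_le_sqrt_pi_mul_exp_neg_three_halves
    linarith
  have hp : 0 ≤ Real.pi ^ 2 := by positivity
  calc 659 / 5000 * (96 * Real.pi ^ 2) = Real.pi ^ 2 * (659 / 5000 * 96) := by ring
    _ ≤ Real.pi ^ 2 * (32 * (Real.sqrt Real.pi * Real.exp (-(3 : ℝ) / 2))) :=
        mul_le_mul_of_nonneg_left key hp
    _ = 32 * Real.pi ^ 2 * Real.sqrt Real.pi * Real.exp (-(3 : ℝ) / 2) := by ring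

/-- **STUB `stub_varianceBudget_of_volumeCertificate` of line `cgy-variance-pivot` — the variance
budget from the volume-comparison certificate, `Vol ≤ 96π²` and `R ≤ 10` (the integration step).**
GIVEN the pointwise certificate `Q(f, R) ≤ 0` on `{0 ≤ R ≤ f ≤ 10}` (first hypothesis, verbatim the
statement of `stub_volumeCertificate`), for Riemannian `g` (Levi-Civita) on a closed 4-manifold and
smooth `f` with `Ric + Hess f = g/2`, `R + |∇f|² = f`, Gaussian mass `∫ e^{-f} dV > Z₀ = 32π²√π e^{-3/2}`,
`Vol ≤ 96π²` and `R ≤ 10` everywhere: `∫(R − 2)² dV < 2·Vol − 96π²`. Proof: (i) `0 < R`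
(`stub_scalarCurvaturePos_of_identities` with (B) from `stub_shrinkerScalarIdentities`), `R ≤ f`
(`|∇f|² = f − R ≥ 0`) and `f ≤ 10` (Fermat at a maximum point of `f`: `df = 0`, so
`f ≤ f(x₀) = R(x₀) ≤ 10`), hence `Q(f(x), R(x)) ≤ 0` pointwise; (ii) integrate over `dV`
(`integral_nonpos`, linearity); (iii) insert `∫R = 2V`, `∫fe^{-f} = 2Z`
(`integral_mul_exp_neg_eq_two_mul`), W1 (`stub_weightedDirichlet`) and U1
(`stub_variance_eq_gradSq_mul`): `D + (38/5)Z − 2V + 142(Z − (659/5000)V) ≤ 0`; (iv) `Z > Z₀`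
(density, `ofReal_integral_eq_lintegral_ofReal`), `V ≤ 96π²`, `(659/5000)·96π² ≤ Z₀`
(`volumeRow_le_room`) and `(38/5)Z₀ ≥ 96π²` (`ninetySix_pi_sq_le_room`). Round model: `0 < 96π²`.
[cite: ChengRibeiroZhou2022, Thm. 2 and Rem. 2] [cite: CarrilloNi2009, §4] -/
theorem stub_varianceBudget_of_volumeCertificate :
    (∀ f R : ℝ, 0 ≤ R → R ≤ f → f ≤ 10 →
      (R - 2) ^ 2 + 38 / 5 * Real.exp (-f) - 2 - 29 / 20 * (R - 2) + 149 * (f - 2) * Real.exp (-f)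
          - 41 * ((f - R) - (f - 2) ^ 2) * Real.exp (-f)
          + 1 / 2 * ((f - R) * (3 - R) - (R - 2) ^ 2)
          + 142 * (Real.exp (-f) - 659 / 5000) ≤ 0) →
    ∀ (M : Type) [TopologicalSpace M] [T2Space M] [SecondCountableTopology M]
      [ChartedSpace (EuclideanSpace ℝ (Fin 4)) M] [IsManifold (𝓡 4) ∞ M] [CompactSpace M]
      [T3Space M] [MeasurableSpace M] [BorelSpace M]
      (g : Literature.Geometry.Lorentzian.PseudoRiemannianMetric (𝓡 4) ∞ (EuclideanSpace ℝ (Fin 4))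
        (TangentSpace (𝓡 4) : M → Type _)) [g.HasLeviCivita] (f : M → ℝ) (hg : g.IsRiemannian),
      ContMDiff (𝓡 4) 𝓘(ℝ, ℝ) ∞ f →
      (∀ (x : M) (X Y : TangentSpace (𝓡 4) x),
        g.ricci x X Y + g.hessian f x X Y = (1 / 2 : ℝ) * g.val x X Y) →
      (∀ x : M, g.scalarCurvature x + g.gradSq f x = f x) →
      ENNReal.ofReal (32 * Real.pi ^ 2 * Real.sqrt Real.pi * Real.exp (-(3 : ℝ) / 2)) <
        ∫⁻ x, ENNReal.ofReal (Real.exp (-f x))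
          ∂(Literature.Geometry.Lorentzian.riemannianMeasure (g.toContMDiffRiemannianMetric hg)) →
      ((Literature.Geometry.Lorentzian.riemannianMeasure (g.toContMDiffRiemannianMetric hg)) Set.univ).toReal ≤
        96 * Real.pi ^ 2 →
      (∀ x : M, g.scalarCurvature x ≤ 10) →
      ∫ x, (g.scalarCurvature x - 2) ^ 2
          ∂(Literature.Geometry.Lorentzian.riemannianMeasure (g.toContMDiffRiemannianMetric hg)) <
        2 * ((Literature.Geometry.Lorentzian.riemannianMeasure (g.toContMDiffRiemannianMetric hg))
              Set.univ).toReal - 96 * Real.pi ^ 2 := by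
  intro hcert M _ _ _ _ _ _ _ _ _ g _ f hg hf hsol hnorm hdens hvol hR10
  have hE : finrank ℝ (EuclideanSpace ℝ (Fin 4)) = 4 := finrank_euclideanSpace_fin
  have hshr : g.IsGradientShrinker f 1 := (g.isGradientShrinker_one_iff f).2 hsol
  -- regularity of `R` and `f`
  have hRc : Continuous g.scalarCurvature := g.contMDiff_scalarCurvature.continuous
  have hfc : Continuous f := hf.continuous
  have hf2 : ContMDiff (𝓡 4) 𝓘(ℝ, ℝ) 2 f := hf.of_le (WithTop.coe_le_coe.mpr le_top)
  have hEc : Continuous fun x ↦ Real.exp (-f x) := Real.continuous_exp.comp hfc.neg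
  -- the normalisation: `|∇f|² = f − R`
  have hG : ∀ x, g.gradSq f x = f x - g.scalarCurvature x := fun x ↦ by linarith [hnorm x]
  -- (i) the pointwise range `0 ≤ R ≤ f ≤ 10`
  obtain ⟨-, hB⟩ := stub_shrinkerScalarIdentities M g f hg hf hsol
  have hR0 : ∀ x, 0 ≤ g.scalarCurvature x := fun x ↦
    (stub_scalarCurvaturePos_of_identities M g f hg hf hsol hB x).le
  have hRf : ∀ x, g.scalarCurvature x ≤ f x := fun x ↦ by
    linarith [hnorm x, g.gradSq_nonneg hg f x]
  have hf10 : ∀ x, f x ≤ 10 := fun x ↦ by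
    obtain ⟨x₀, -, hmax⟩ := isCompact_univ.exists_isMaxOn ⟨x, mem_univ x⟩ hfc.continuousOn
    have hd : mvfderiv (𝓡 4) f x₀ = 0 := mvfderiv_eq_zero_of_isMaxOn hmax
    have h0 : g.gradSq f x₀ = 0 := by
      simp [PseudoRiemannianMetric.gradSq, hd, PseudoRiemannianMetric.innerDual]
    have h1 := hnorm x₀
    calc f x ≤ f x₀ := hmax (mem_univ x)
      _ = g.scalarCurvature x₀ := by linarith
      _ ≤ 10 := hR10 x₀
  -- (iii) the landed members, for the Riemannian measure
  have hC3 := integral_mul_exp_neg_eq_two_mul M g f hg hf hsol hnorm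
  have hW1 := stub_weightedDirichlet M g f hg hf hsol hnorm
  have hU1 := stub_variance_eq_gradSq_mul M g f hg hf hsol hnorm
  -- the Riemannian measure is `g.riemVolume`, a finite measure
  have hV : g.riemVolume = riemannianMeasure (g.toContMDiffRiemannianMetric hg) :=
    PseudoRiemannianMetric.riemVolume_eq hg
  haveI : IsFiniteMeasure g.riemVolume := ⟨g.riemVolume_univ_lt_top⟩
  rw [← hV] at hC3 hW1 hU1 hdens hvol ⊢
  simp_rw [hG] at hW1 hU1
  -- integrability of the (continuous) integrands
  have iE : Integrable (fun x ↦ Real.exp (-f x)) g.riemVolume := integrable_exp_neg_of_contMDiff hf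
  have iR : Integrable g.scalarCurvature g.riemVolume := g.integrable_of_continuous hRc
  have iFE : Integrable (fun x ↦ f x * Real.exp (-f x)) g.riemVolume :=
    g.integrable_of_continuous (hfc.mul hEc)
  have i5 : Integrable (fun x ↦ (f x - g.scalarCurvature x) * Real.exp (-f x)) g.riemVolume :=
    g.integrable_of_continuous ((hfc.sub hRc).mul hEc)
  have i6 : Integrable (fun x ↦ (f x - 2) ^ 2 * Real.exp (-f x)) g.riemVolume :=
    g.integrable_of_continuous (((hfc.sub continuous_const).pow 2).mul hEc)
  have i7 : Integrable (fun x ↦ (f x - g.scalarCurvature x) * (3 - g.scalarCurvature x))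
      g.riemVolume :=
    g.integrable_of_continuous ((hfc.sub hRc).mul (continuous_const.sub hRc))
  have iD : Integrable (fun x ↦ (g.scalarCurvature x - 2) ^ 2) g.riemVolume :=
    g.integrable_of_continuous ((hRc.sub continuous_const).pow 2)
  -- C2: the traced soliton equation `R + Δf = 2` and `∫ Δf = 0` give `∫ R = 2 Vol`
  have hΔf : ∀ x, g.dalembertian f x = 2 - g.scalarCurvature x := fun x ↦ by
    have h := hshr.scalarCurvature_add_dalembertian_one x
    rw [hE] at h
    norm_num at h
    linarith
  have e1 : ∫ x, g.scalarCurvature x ∂g.riemVolume = 2 * (g.riemVolume univ).toReal := by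
    have h0 := integral_dalembertian_riemVolume_eq_zero g hg hf2
    simp_rw [hΔf] at h0
    rw [integral_sub (integrable_const _) iR, integral_const, smul_eq_mul, Measure.real] at h0
    linarith
  -- (ii) integrate the certificate over `dV`
  have hQ0 : ∫ x, ((g.scalarCurvature x - 2) ^ 2 + 38 / 5 * Real.exp (-f x) - 2
      - 29 / 20 * (g.scalarCurvature x - 2) + 149 * (f x - 2) * Real.exp (-f x)
      - 41 * ((f x - g.scalarCurvature x) - (f x - 2) ^ 2) * Real.exp (-f x)
      + 1 / 2 * ((f x - g.scalarCurvature x) * (3 - g.scalarCurvature x)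
          - (g.scalarCurvature x - 2) ^ 2)
      + 142 * (Real.exp (-f x) - 659 / 5000)) ∂g.riemVolume ≤ 0 :=
    integral_nonpos fun x ↦ hcert (f x) (g.scalarCurvature x) (hR0 x) (hRf x) (hf10 x)
  have hQ : ∫ x, ((g.scalarCurvature x - 2) ^ 2 + 38 / 5 * Real.exp (-f x) - 2
      - 29 / 20 * (g.scalarCurvature x - 2) + 149 * (f x - 2) * Real.exp (-f x)
      - 41 * ((f x - g.scalarCurvature x) - (f x - 2) ^ 2) * Real.exp (-f x)
      + 1 / 2 * ((f x - g.scalarCurvature x) * (3 - g.scalarCurvature x)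
          - (g.scalarCurvature x - 2) ^ 2)
      + 142 * (Real.exp (-f x) - 659 / 5000)) ∂g.riemVolume =
      ∫ x, ((-742) / 5 * Real.exp (-f x) + (-44539) / 2500 + (-29) / 20 * g.scalarCurvature x
        + 149 * (f x * Real.exp (-f x))
        + (-41) * ((f x - g.scalarCurvature x) * Real.exp (-f x))
        + 41 * ((f x - 2) ^ 2 * Real.exp (-f x))
        + 1 / 2 * ((f x - g.scalarCurvature x) * (3 - g.scalarCurvature x))
        + 1 / 2 * (g.scalarCurvature x - 2) ^ 2) ∂g.riemVolume :=
    integral_congr_ae (ae_of_all _ fun x ↦ by ring)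
  rw [hQ, integral_lincomb₈ iE iR iFE i5 i6 i7 iD] at hQ0
  -- (iv) the density hypothesis as a real (Bochner) integral, and the numerics
  rw [← ofReal_integral_eq_lintegral_ofReal iE (ae_of_all _ fun x ↦ (Real.exp_pos _).le),
    ENNReal.ofReal_lt_ofReal_iff'] at hdens
  have hnum := ninetySix_pi_sq_le_room
  have hrow := volumeRow_le_room
  linarith [hdens.1]

end Summit.SmoothPoincare4.SmoothPoincare4.Theorems

end
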